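import Literature.MathematicalPhysics.QuantumFieldTheory.Balaban1983to89.Node00.Record13CarriersB8SubBP2DCoPH
import Literature.MathematicalPhysics.QuantumFieldTheory.Balaban1983to89.Node00.Record13SClassSepCoPHG

/-!
# NODE 00 (YM-PLAN Track A) — THE G-CLASS SLICE OF THE «P₂D» ONE-PIN RECORD: every record of
# `IsRecordOfRecord₁₃CSepCoPHSB8subBP₂D` (width seat `pub-ymgap-dag-n05-w1` g2, `Node00/Record13CarriersB8SubBP2DCoPH`) IS a member of the
# `b8`-GENERIC S-class `IsRecordOfRecord₁₃CSepCoPHG` (width seat `pub-ymgap-dag-n05-w4` g2, `Node00/Record13SClassSepCoPHG`, p607735); through it the class's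
# consequence family — same-constants C-companion, guarded (0.20), END FROM NODES — applies at every «P₂D» one-pin record BY NAME

NODE 00 RECORD MODULE (width seat `pub-ymgap-dag-n05-w1` g2, 2026-08-28; the piece worded to this seat by plan g83 WORDS-3 (n05) option (b) and by
dag-n05-w4 g2 (cell bus 2026-08-28 05:44Z ∕ 05:53Z)).  APPEND-ONLY: a NEW importing module; NOTHING in `Record13CarriersB8SubBP2DCoPH` (this seat, g0),
`Record13SClassSepCoPHG` (dag-n05-w4), `Record13SClassSepCoPH` ∕ `Record13CarriersSepCoPH` ∕ `Record13CarriersCoPH` (dag-n10-d), `Record13CarriersB8SubBP2C`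
(this seat, g0) or below them is edited — everything is CONSUMED BY NAME.  A new module rather than a v1.1 append of `Record13CarriersB8SubBP2DCoPH` only because
that file stands at 373 lines (≤ 400-line cap).

WHY.  The «P₂D» image `Record13CarriersB8SubBP2DCoPH` of the ONE-pin S-bound record binds its world, run by run, to this seat's REPAIRED-CURRENCY binding
`upOfRecord₅CSC ((θ.pinB8SubBP₂D lam).toStage5₁₃CoPH) (c₇OfRecord θ.toStage3Params)` (`withB8 (B8LeafRSC … C₇ …)`: Proposition 7 of [Balaban1985RegularSpaces] in the
repaired currency for print's tower map), NOT to the RS binding `upOfRecord₅CS` that dag-n10-d's generic S-class `IsRecordOfRecord₁₃CSepCoPHS` hard-wires; so the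
parent's membership lemma `isRecordOfRecord₁₃CSepCoPHS_of_isRecordOfRecord₁₃CSepCoPHSB8subBH` had NO image there (LOCATED-SCLASS-CURRENCY, cell bus 2026-08-28 04:22Z;
the NOTE block of that file's §2).  The planners answered with option (b) — dag-n05-w4's `b8`-generic class `IsRecordOfRecord₁₃CSepCoPHG` (world bound to
`(upOfRecord₅C …).withB8 (b8sel P)` for SOME run-indexed `b8sel`; RS ⊂ G, C ⊂ G, SC pointed ∕ hosted).  THIS FILE is the owed image: the one-pin SC SLICE of the G-class.

WHAT IS PROVED (kernel bookkeeping, 0 sorry, 0 def, no new mathematics).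
§1 `isRecordOfRecord₁₃CSepCoPHG_pinB8SubBP₂D_of_eq_upSC` (POINTED: a world with `w.C = (datumOfRecord₁₃SepCoPH θ h).C`, `0 < w.γ ≤ θ.γ`, `w.L = θ.L`, bound to
`upOfRecord₅CSC ((θ.pinB8SubBP₂D lam).toStage5₁₃CoPH) (c₇OfRecord θ.toStage3Params)`, is a G-class record AT θ's OWN DATUM — the [B8″P] instance of dag-n05-w4's
`isRecordOfRecord₁₃CSepCoPHG_rebindX_of_eq` with `b8sel := fun _ => B8LeafOfRecordSubBP₂D θ.toStage3Params lam`, `rfl` on `upOfRecord₅CSC`), ★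
`isRecordOfRecord₁₃CSepCoPHG_of_isRecordOfRecord₁₃CSepCoPHSB8subBP₂D` (THE MEMBERSHIP: every «P₂D» one-pin record is a G-class record of the same datum and world).
§2 BY-NAME CONSEQUENCES at a «P₂D» one-pin record (dag-n05-w4's §2 read through the membership): `companionC_of_isRecordOfRecord₁₃CSepCoPHSB8subBP₂D` (the
same-constants C-companion — `C`, `γ`, `L`, `b`, `βup` — with leaves agreeing off `b8`), `rgFlow_of_smallCouplings_of_isRecordOfRecord₁₃CSepCoPHSB8subBP₂D` (the
guarded (0.20) leaf), ★ `endStatementBPrinted_of_isRecordOfRecord₁₃CSepCoPHSB8subBP₂D_of_nodes` (END FROM NODES: the DAG's nodes at every run + the β bounds in a window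
`γ₀ ≥ w.γ` give print's END STATEMENT (B) for `D.C` — node00-def's `endStatementBPrinted_of_nodesP_interval_guarded`, reached through the G-class entry), and the
datum-displayed form `endStatementBPrinted_datumOfRecord₁₃SepCoPH_of_pinB8SubBP₂D_upSC_of_nodes` (conclusion literally `B16.EndStatementBPrinted (datumOfRecord₁₃SepCoPH F N θ h).C`,
the shape the K1⁷ text displays at `N = 2`).
HONEST SCOPE: one ∃-repackaging + one-line ports; NO estimate; nothing of Bałaban's asserted; the hypotheses «nodes at every run» and «β bounds in the window» are
DISPLAYED, not discharged; whether any K1⁷ edition reads the G-class is the planners' ∕ director's word (K1⁷ v6 reads `RecordS` = the RS class, which STANDS); N05 NOT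
discharged; K1 NOT claimed; counts unmoved; count-neutral.  HONEST FRAMING: one finite T⁴ programme at fixed ε, Bałaban AS PRINTED — NOT continuum ∕ ℝ⁴ ∕ infinite
volume ∕ OS ∕ mass gap ∕ Clay; route R4 closes the conditional finite-𝕋⁴ rung `BalabanLadder.UV` only.  No `sorry`, no `axiom`, no `opaque`, no `instance`, no `notation`.
[Balaban1985RegularSpaces] = Commun. Math. Phys. **99** (1985) 75–102; [Balaban1989LargeFieldII] = Commun. Math. Phys. **122** (1989) 355–392; [Balaban1988Convergent] =
Commun. Math. Phys. **119** (1988) 243–285; [Balaban1987RG1] = Commun. Math. Phys. **109** (1987) 249–301. -/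

noncomputable section

namespace Literature.MathematicalPhysics.QuantumFieldTheory.Balaban1983to89.Node00

open T4Continuum AveragingRT T4FiniteEpsInhabited FlowStep FlowStepRuns DagBinding T4DatumAssembly
open scoped Matrix.Norms.L2Operator

/-! ## §1. The «P₂D» one-pin record IS a G-class record (pointed form; membership) -/

section GSlice

variable (F : T4Family) (N : ℕ) [NeZero N]

/-- **Pointed form** — the [B8″P] one-pin instance of dag-n05-w4's `isRecordOfRecord₁₃CSepCoPHG_rebindX_of_eq`: a world with def-T's pointed clauses at `θ` whose upstream
blocks are this seat's REPAIRED-CURRENCY binding `upOfRecord₅CSC … (c₇OfRecord θ.toStage3Params)` over the [B8″P]-PINNED Co Stage-13 view is a G-class record AT θ's OWN DATUM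
(presenting parameter `θ.pinB8SubBP₂D lam` = one H-level `rebindX`; `b8sel := fun _ => B8LeafOfRecordSubBP₂D θ.toStage3Params lam`, the P-slot, `rfl` on `upOfRecord₅CSC`).
[cite: Balaban1985RegularSpaces, Prop. 7 p.100, Thm 8 (1.146) p.101 (repaired currency, objects of record); Balaban1989LargeFieldII, Thm 1 + (0.1) pp.355–356 (bookkeeping)] -/
theorem isRecordOfRecord₁₃CSepCoPHG_pinB8SubBP₂D_of_eq_upSC (θ : Stage13HParams F N) (h : θ.Provisos₁₃SepCoPH F N) (hθ : θ.Admissible F N)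
    (lam : ResidB8 θ.toStage3Params) (w : WorldP) (hC : w.C = (datumOfRecord₁₃SepCoPH F N θ h).C) (hγ : 0 < w.γ ∧ w.γ ≤ θ.γ) (hL : w.L = (θ.L : ℝ))
    (hup : ∀ P, w.up P = upOfRecord₅CSC F N ((θ.pinB8SubBP₂D F N lam).toStage5₁₃CoPH F N) (c₇OfRecord θ.toStage3Params) P) :
    IsRecordOfRecord₁₃CSepCoPHG F N (datumOfRecord₁₃SepCoPH F N θ h) w :=
  isRecordOfRecord₁₃CSepCoPHG_rebindX_of_eq F N θ h hθ (fun P => (θ.res.X P).withB8OfRecordSubBP₂D θ.toStage3Params lam)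
    (fun _ => B8LeafOfRecordSubBP₂D θ.toStage3Params lam) w hC hγ hL (fun P => by rw [hup P]; rfl)

variable {F N}
variable {D : FiniteEpsData F (SU N)} {w : WorldP}

/-- ★ **A «P₂D» ONE-PIN RECORD IS A MEMBER OF dag-n05-w4's `b8`-GENERIC S-CLASS `IsRecordOfRecord₁₃CSepCoPHG`** (`Record13SClassSepCoPHG`, p607735) — same datum, same
world: presenting parameter the [B8″P]-pinned one `θ.pinB8SubBP₂D lam`, provisos `Provisos₁₃SepCoPH.pinB8SubBP₂D`, admissibility `Iff.rfl`, datum UP-SIDE, `b8sel` the P-slot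
`B8LeafOfRecordSubBP₂D θ.toStage3Params lam`; the one-pin SC SLICE of the class — the «P₂D» image of the parent's `isRecordOfRecord₁₃CSepCoPHS_of_isRecordOfRecord₁₃CSepCoPHSB8subBH`
that `Record13CarriersB8SubBP2DCoPH` could not carry (its NOTE, LOCATED-SCLASS-CURRENCY).  Through it the class's consequence family applies at every record of that module BY NAME (§2).
[cite: Balaban1985RegularSpaces, Lemma 1 – Thm 8 pp.79–101, Prop. 7 p.100 (repaired currency); Balaban1989LargeFieldII, Thm 1 + (0.1) pp.355–356 (bookkeeping)] -/
theorem isRecordOfRecord₁₃CSepCoPHG_of_isRecordOfRecord₁₃CSepCoPHSB8subBP₂D (h : IsRecordOfRecord₁₃CSepCoPHSB8subBP₂D F N D w) :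
    IsRecordOfRecord₁₃CSepCoPHG F N D w := by
  obtain ⟨θ, hP, lam, hθ, hD, hC, hγ, hL, hup⟩ := h
  subst hD
  exact isRecordOfRecord₁₃CSepCoPHG_pinB8SubBP₂D_of_eq_upSC F N θ hP hθ lam w hC hγ hL hup

end GSlice

/-! ## §2. BY-NAME CONSEQUENCES at a «P₂D» one-pin record: the same-constants C-companion, the guarded (0.20) leaf, END FROM NODES -/

section Consequences

variable {F : T4Family} {N : ℕ} [NeZero N]
variable {D : FiniteEpsData F (SU N)} {w : WorldP}

/-- **THE SAME-CONSTANTS C-COMPANION** of a «P₂D» one-pin record (dag-n05-w4's `companionC_of_isRecordOfRecord₁₃CSepCoPHG` through the membership): a def-T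
`IsRecordOfRecord₁₃CSepCoPH` record AT THE SAME DATUM with the same `C`, `γ`, `L`, `b`, `βup`, leaves agreeing off `b8`.  (The module's own `companion_of_…` adds the
`b8` implication typed ⇒ surviving; this one adds `b`, `βup`.) [cite: Balaban1989LargeFieldII, Thm 1 + (0.1) pp.355–356; Balaban1985RegularSpaces, Thm 8 p.101 (bookkeeping)] -/
theorem companionC_of_isRecordOfRecord₁₃CSepCoPHSB8subBP₂D (h : IsRecordOfRecord₁₃CSepCoPHSB8subBP₂D F N D w) :
    ∃ w' : WorldP, IsRecordOfRecord₁₃CSepCoPH F N D w' ∧ w'.C = w.C ∧ w'.γ = w.γ ∧ w'.L = w.L ∧ w'.b = w.b ∧ w'.βup = w.βup ∧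
      ∀ P : B12.RunParams, leavesP w P = { leavesP w' P with b8 := (leavesP w P).b8 } :=
  companionC_of_isRecordOfRecord₁₃CSepCoPHG (isRecordOfRecord₁₃CSepCoPHG_of_isRecordOfRecord₁₃CSepCoPHSB8subBP₂D h)

/-- **GUARDED (0.20) AT EVERY «P₂D» ONE-PIN RECORD** (the leaf reads `w.C`, `w.γ` only — dag-n05-w4's G-class instance through the membership).
[cite: Balaban1987RG1, (0.20) p.256 (bookkeeping)] -/
theorem rgFlow_of_smallCouplings_of_isRecordOfRecord₁₃CSepCoPHSB8subBP₂D (h : IsRecordOfRecord₁₃CSepCoPHSB8subBP₂D F N D w) (P : B12.RunParams)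
    (hsc : (leavesP w P).smallCouplings) : (leavesP w P).rgFlow :=
  rgFlow_of_smallCouplings_of_isRecordOfRecord₁₃CSepCoPHG (isRecordOfRecord₁₃CSepCoPHG_of_isRecordOfRecord₁₃CSepCoPHSB8subBP₂D h) P hsc

/-- ★ **END FROM NODES AT A «P₂D» ONE-PIN RECORD**: the DAG's nodes at every run of the record's world and the β bounds in a window `γ₀ ≥ w.γ` give print's END STATEMENT (B)
for `D.C` — node00-def's `endStatementBPrinted_of_nodesP_interval_guarded` with the guarded (0.20) leaf, reached through the G-class entry
`endStatementBPrinted_of_isRecordOfRecord₁₃CSepCoPHG_of_nodes`.  The two hypotheses are DISPLAYED, not discharged (the nodes are the lanes' business; N05's `b8` at this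
record is the P-slot `B8LeafOfRecordSubBP₂D`, cf. `b8_main_of_isRecordOfRecord₁₃CSepCoPHSB8subBP₂D_of_fields`).
[cite: Balaban1989LargeFieldII, Thm 1 + (0.1) pp.355–356; Balaban1987RG1, (0.20) p.256; Balaban1988Convergent, Thms 1–2 pp.262–263 (bookkeeping)] -/
theorem endStatementBPrinted_of_isRecordOfRecord₁₃CSepCoPHSB8subBP₂D_of_nodes (h : IsRecordOfRecord₁₃CSepCoPHSB8subBP₂D F N D w) {γ₀ : ℝ} (hγ₀ : w.γ ≤ γ₀)
    (hnodes : ∀ P, Nodes (leavesP w P)) (hβ : BetaBoundsInInterval w.C.toB12 γ₀ w.b w.βup) :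
    B16.EndStatementBPrinted D.C :=
  endStatementBPrinted_of_isRecordOfRecord₁₃CSepCoPHG_of_nodes (isRecordOfRecord₁₃CSepCoPHG_of_isRecordOfRecord₁₃CSepCoPHSB8subBP₂D h) hγ₀ hnodes hβ

/-- **END FROM NODES, DATUM DISPLAYED** (pointed composition of §1's pointed form with the G-class END entry): at admissible v1.7 parameters `θ` with the v1.7 provisos `h`,
ANY residual [B8] layer `lam`, a world with def-T's pointed clauses bound to this seat's repaired-currency binding over the [B8″P]-pinned Co view, all DAG nodes at every run
and the β bounds in a window `γ₀ ≥ w.γ` give `B16.EndStatementBPrinted (datumOfRecord₁₃SepCoPH F N θ h).C` — the conclusion in the letter the K1⁷ text displays (at `N = 2`).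
Hypotheses displayed, not discharged. [cite: Balaban1989LargeFieldII, Thm 1 + (0.1) pp.355–356; Balaban1988Convergent, Thms 1–2 pp.262–263; Balaban1985RegularSpaces, Thm 8 p.101 (bookkeeping)] -/
theorem endStatementBPrinted_datumOfRecord₁₃SepCoPH_of_pinB8SubBP₂D_upSC_of_nodes (θ : Stage13HParams F N) (h : θ.Provisos₁₃SepCoPH F N) (hθ : θ.Admissible F N)
    (lam : ResidB8 θ.toStage3Params) (w : WorldP) (hC : w.C = (datumOfRecord₁₃SepCoPH F N θ h).C) (hγ : 0 < w.γ ∧ w.γ ≤ θ.γ) (hL : w.L = (θ.L : ℝ))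
    (hup : ∀ P, w.up P = upOfRecord₅CSC F N ((θ.pinB8SubBP₂D F N lam).toStage5₁₃CoPH F N) (c₇OfRecord θ.toStage3Params) P)
    {γ₀ : ℝ} (hγ₀ : w.γ ≤ γ₀) (hnodes : ∀ P, Nodes (leavesP w P)) (hβ : BetaBoundsInInterval w.C.toB12 γ₀ w.b w.βup) :
    B16.EndStatementBPrinted (datumOfRecord₁₃SepCoPH F N θ h).C :=
  endStatementBPrinted_of_isRecordOfRecord₁₃CSepCoPHG_of_nodes (isRecordOfRecord₁₃CSepCoPHG_pinB8SubBP₂D_of_eq_upSC F N θ h hθ lam w hC hγ hL hup) hγ₀ hnodes hβ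

end Consequences

end Literature.MathematicalPhysics.QuantumFieldTheory.Balaban1983to89.Node00

end
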